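import Mathlib
import Summits.ValiantsHypothesis.ValiantsHypothesis.Theorems.FeketeSOSFeketeNoSparseSplitFeketeModPOrder

/-!
# Crux `FeketeSOS.CharPSparseSOS` (stmt-ValiantsHypothesis-14989), line `Sketch` — stub `stub_feketeCuspZero`

The `0`-cusp half of the two-cusp composition.  In a field `K` of characteristic `p ≠ 2` write
`M = (p-1)/2` and `F̄_p = Σ_{m<p} ((m|p) : K) X^m` (the crux's inlined reduced Fekete polynomial), whose
coefficient function is `n ↦ χ_p(n) = ((n|p) : K)`.  Then

* `χ_p(0) = 0` (the constant coefficient of `F̄_p` vanishes);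
* the top moments `Σ_{n<p} χ_p(n) n^{p-1-d}` vanish for `1 ≤ d < M`;
* the top moment at `d = M`, `Σ_{n<p} χ_p(n) n^{p-1-M} = Σ_{n<p} χ_p(n) n^{M}`, is non-zero.

Proof.  By Euler's criterion in `K` (`χ_p(n) = n^{p/2} = n^M`, the tree's `fmo_intCast_legendreSym`)
every moment is a power sum `Σ_{n<p} n^{M+e}`.  Power sums in characteristic `p`: `Σ_{n<p} n^j = 0` for
`j < p-1` (Mathlib's `FiniteField.sum_pow_lt_card_sub_one` over `ZMod p`, transported along
`ZMod.castHom : ZMod p →+* K` by reindexing `range p ≃ ZMod p`), and `Σ_{n<p} n^{p-1} = p-1 = -1` (Fermat,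
`ZMod.pow_card_sub_one_eq_one`).  For `1 ≤ d < M` the exponent is `M + (p-1-d) = (p-1) + (M-d)` with
`0 < M-d < p-1`, so by Fermat the moment is `Σ_{n<p} n^{M-d} = 0`; at `d = M` the exponent is `p-1` and
the moment is `-1 ≠ 0`.
-/

-- `Summit.ValiantsHypothesis.ValiantsHypothesis.…` is the tree's mandated single-conjunct layout (Sub = Summit).
set_option linter.dupNamespace false

namespace Summit.ValiantsHypothesis.ValiantsHypothesis.Theorems.CharPSparseSOSTwoCusp

open Polynomial Finset

section Helpers

variable {K : Type*} [Field K] (p : ℕ) [Fact p.Prime]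

/-- The `n`-th coefficient of the inlined sum `Σ_{m<p} ((m|p) : K) X^m` is `((n|p) : K)` for `n < p`.
[folklore] -/
theorem fcz_coeff_sum (n : ℕ) (hn : n < p) :
    (∑ m ∈ Finset.range p, C ((legendreSym p m : ℤ) : K) * X ^ m).coeff n
      = ((legendreSym p n : ℤ) : K) := by
  simp only [finsetSum_coeff, coeff_C_mul_X_pow, Finset.sum_ite_eq, Finset.mem_range, if_pos hn]

variable [CharP K p]

/-- Reindexing `range p ≃ ZMod p` (`n ↦ (n : ZMod p)`, inverse `ZMod.val`): a power sum over
`n < p` in `K` is the image under `ZMod.castHom` of the power sum over `ZMod p`. [folklore] -/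
theorem fcz_sum_range_pow_eq (j : ℕ) :
    ∑ n ∈ Finset.range p, (n : K) ^ j = ∑ x : ZMod p, (ZMod.castHom (dvd_refl p) K x) ^ j := by
  refine Finset.sum_nbij' ((↑) : ℕ → ZMod p) ZMod.val (fun _ _ => Finset.mem_univ _)
    (fun x _ => Finset.mem_range.mpr (ZMod.val_lt x))
    (fun n hn => ZMod.val_cast_of_lt (Finset.mem_range.mp hn))
    (fun x _ => ZMod.natCast_zmod_val x) fun n _ => ?_
  rw [map_natCast]

/-- **Vanishing power sums**: `Σ_{n<p} n^j = 0` in `K` for `j < p - 1`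
(Mathlib's `FiniteField.sum_pow_lt_card_sub_one` over `ZMod p`). [folklore] -/
theorem fcz_sum_pow_eq_zero (j : ℕ) (hj : j < p - 1) :
    ∑ n ∈ Finset.range p, (n : K) ^ j = 0 := by
  have h := FiniteField.sum_pow_lt_card_sub_one (ZMod p) j (by rwa [ZMod.card])
  rw [fcz_sum_range_pow_eq p j]
  simp_rw [← map_pow]
  rw [← map_sum, h, map_zero]

/-- **Fermat in `K`**: `m^{p-1} = 1` for `0 < m < p` (`ZMod.pow_card_sub_one_eq_one` transported along
`ZMod.castHom`). [folklore] -/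
theorem fcz_natCast_pow_sub_one (m : ℕ) (h0 : 0 < m) (hlt : m < p) : (m : K) ^ (p - 1) = 1 := by
  have hne : (m : ZMod p) ≠ 0 := by
    rw [Ne, ZMod.natCast_eq_zero_iff]
    exact Nat.not_dvd_of_pos_of_lt h0 hlt
  have h := congrArg (ZMod.castHom (dvd_refl p) K) (ZMod.pow_card_sub_one_eq_one hne)
  rwa [map_pow, map_natCast, map_one] at h

/-- **The top power sum**: `Σ_{n<p} n^{p-1} = -1` in `K` (the `n = 0` term vanishes, the other `p - 1`
terms are `1` by Fermat, and `p - 1 = -1` in characteristic `p`). [folklore] -/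
theorem fcz_sum_pow_card_sub_one : ∑ n ∈ Finset.range p, (n : K) ^ (p - 1) = -1 := by
  have hp : p.Prime := Fact.out
  have h2 := hp.two_le
  have h : ∑ n ∈ Finset.range p, (n : K) ^ (p - 1)
      = ∑ n ∈ Finset.range (p - 1 + 1), (n : K) ^ (p - 1) := by
    rw [Nat.sub_add_cancel hp.one_le]
  rw [h, Finset.sum_range_succ', Nat.cast_zero, zero_pow (by omega), add_zero,
    Finset.sum_eq_card_nsmul (fun n hn => fcz_natCast_pow_sub_one p (n + 1) n.succ_pos
      (by have := Finset.mem_range.mp hn; omega)),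
    Finset.card_range, nsmul_eq_mul, mul_one, Nat.cast_sub hp.one_le, Nat.cast_one,
    CharP.cast_eq_zero K p, zero_sub]

end Helpers

/-- **Stub 2 (`0`-cusp of the target).** In a field `K` of characteristic `p ≠ 2`, the coefficient
function `n ↦ ((n|p) : K)` of `F̄_p = Σ_{m<p} ((m|p) : K) X^m` vanishes at `n = 0`, its top moments
`Σ_{n<p} (n|p) n^{p-1-d}` vanish for `1 ≤ d < (p-1)/2`, and the one at `d = (p-1)/2` is non-zero
(Euler's criterion + power sums in characteristic `p`). [folklore] -/
theorem stub_feketeCuspZero :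
    ∀ (K : Type) [Field K] (p : ℕ) [Fact p.Prime] [CharP K p], p ≠ 2 →
      (∑ m ∈ Finset.range p, C ((legendreSym p m : ℤ) : K) * X ^ m).coeff 0 = 0 ∧
      (∀ d : ℕ, 1 ≤ d → d < (p - 1) / 2 →
        ∑ n ∈ Finset.range p,
          (∑ m ∈ Finset.range p, C ((legendreSym p m : ℤ) : K) * X ^ m).coeff n
            * (n : K) ^ (p - 1 - d) = 0) ∧
      ∑ n ∈ Finset.range p,
          (∑ m ∈ Finset.range p, C ((legendreSym p m : ℤ) : K) * X ^ m).coeff n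
            * (n : K) ^ (p - 1 - (p - 1) / 2) ≠ 0 := by
  intro K _ p _ _ hp2
  have hp : p.Prime := Fact.out
  obtain ⟨M, hM⟩ : ∃ M, p = 2 * M + 1 :=
    hp.eq_two_or_odd'.resolve_left hp2 |>.imp fun M h => by omega
  -- every moment is a power sum (Euler's criterion)
  have hmom : ∀ e : ℕ, ∑ n ∈ Finset.range p,
      (∑ m ∈ Finset.range p, C ((legendreSym p m : ℤ) : K) * X ^ m).coeff n * (n : K) ^ e
        = ∑ n ∈ Finset.range p, (n : K) ^ (p / 2 + e) := by
    intro e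
    refine Finset.sum_congr rfl fun n hn => ?_
    rw [fcz_coeff_sum p n (Finset.mem_range.mp hn),
      FeketeNoSparseSplitCyclic.fmo_intCast_legendreSym, pow_add]
  refine ⟨?_, ?_, ?_⟩
  · -- χ_p(0) = 0
    rw [fcz_coeff_sum p 0 hp.pos, Nat.cast_zero, legendreSym.at_zero, Int.cast_zero]
  · -- 1 ≤ d < M: exponent (p-1) + (M-d) with 0 < M-d < p-1
    intro d hd1 hdM
    rw [hmom]
    have key : ∑ n ∈ Finset.range p, (n : K) ^ (p / 2 + (p - 1 - d))
        = ∑ n ∈ Finset.range p, (n : K) ^ (M - d) := by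
      refine Finset.sum_congr rfl fun n hn => ?_
      rcases Nat.eq_zero_or_pos n with rfl | hn0
      · rw [Nat.cast_zero, zero_pow (by omega), zero_pow (by omega)]
      · rw [show p / 2 + (p - 1 - d) = (p - 1) + (M - d) by omega, pow_add,
          fcz_natCast_pow_sub_one p n hn0 (Finset.mem_range.mp hn), one_mul]
    rw [key]
    exact fcz_sum_pow_eq_zero p (M - d) (by omega)
  · -- d = M: exponent p - 1, the sum is -1
    rw [hmom, show p / 2 + (p - 1 - (p - 1) / 2) = p - 1 by omega, fcz_sum_pow_card_sub_one p]
    exact neg_ne_zero.mpr one_ne_zero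

end Summit.ValiantsHypothesis.ValiantsHypothesis.Theorems.CharPSparseSOSTwoCusp
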